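import Summits.ResolutionOfSingularities.ResolutionOfSingularities.Theorems.DeltaCutStellarLatGuard

/-!
# StellarCut J21a — «LatJet»: the LATENT-JET shape `ncHypShapeLatJ` (Artin–Schreier presentation WITHOUT the coprime clause, WITH a
# logarithmic eigen-datum), its accessors, and its TERMINAL EXIT into T19's jet shape
# (lens-6 «barrier-complement carving», g36 door 2; engine of the cell `WORNCHypWildLatJ` carved out of `WORNCHypWildRest3`)

L20's latent class `ncHypShapeLat` (Artin–Schreier stalks `(hᵖ + v·(h − c·m_μ)·m_b·m_μ^{p−1})`) asks the TERMINAL labels `b` to be `0`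
or prime to `p`: its mass-`0` exit is T18's coprime shape.  Hauser's oblique kangaroo `x² + (1+xz)z²w²` (char `2`) is
Artin–Schreier for `h = x + zw` — `h² + (h + zw)·z²w·zw` — with the EVEN terminal label `b = (2, 1)`: outside L20's class and
outside T19's (no jet datum at the origin of the binomial frame).  The «LatJet» class drops the coprime clause and adds a
**logarithmic eigen-datum**: a derivation `δ` of `𝒪_y` (T19a's `IsDeriv`), logarithmic along `H` and every boundary member through
`y`, with `δ(v·c·m_b) = λ·(v·c·m_b)`, `λ ∈ 𝒪_y^×` — the twisted terminal monomial is a `δ`-eigenvector with UNIT eigenvalue (for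
the kangaroo: `δ = w∂_w`, `λ = 1`).  `p = 0` does the work three times: the datum is transported EXACTLY through the latent hops
(J21b: `δ'(v₃ᵖ) = 0`), the Artin–Schreier chart guard is L20c's (from `p = 0`), and at latent mass `0` the datum IS a T19 jet datum
at every `p`-divisible point (this file, §Exit: `δ(m₀ᵖ) = δ(m_μᵖ) = 0`).

* §Shape — `LatJAt p E L H I y` (the per-point datum), `ncHypShapeLatJ p X E L H M` and its API.
* §Root — at a `p`-divisible point the frame monomial is a `p`-th power up to a unit (`exists_eq_unit_mul_pow_of_divPt`).
* §Exit — ★ `ncHypShapeLatJ.toJet`: latent mass `0` ⇒ `ncHypShapeJet p X E H M` (T19's class; its list law then applies BY NAME).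
* §Hop — permissibility of the latent face `{H, K}` for the new class (`ncHypShapeLatJ.support_pair_subset`; L20a's argument).

0 sorry; axioms standard. [new] [cite: CossartPiltant2008, Prop. 4.2] [cite: Hauser2010, §5] [cite: Kollar2007, (3.111) Step 3]
[cite: Cutkosky2011, §8]
-/
noncomputable section

open CategoryTheory CategoryTheory.Limits AlgebraicGeometry TopologicalSpace IsLocalRing
open Literature.AlgebraicGeometry.Resolution

namespace Summit.ResolutionOfSingularities.ResolutionOfSingularities.Theorems.DeltaCutClasses

open Summit.ResolutionOfSingularities.ResolutionOfSingularities.Theorems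
open WeakOrderReduction ForcedTowerClasses

/-! ### §Shape — the latent-jet shape -/

section Shape

variable {X : Scheme.{0}}

/-- **`LatJAt p E L H I y` — THE LATENT-JET DATUM at `y` for the ideal sheaf `I`**: an Artin–Schreier presentation
`I_y = (hᵖ + v·(h − c·m_μ)·m_b·m_μ^{p−1})` (`c, v` units, `(h) = H_y`, `(m_b) = 𝓜(E)_y`, `(m_μ) = 𝓜(L)_y`) TOGETHER WITH a derivation
`δ` of `𝒪_y`, logarithmic for every member of `H :: ∂E` through `y`, and a unit `λ` with `δ(v·c·m_b) = λ·(v·c·m_b)`. DEFINITION. [new] -/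
def LatJAt (p : ℕ) (E L : List (X.IdealSheafData × ℕ)) (H I : X.IdealSheafData) (y : X) : Prop :=
  ∃ (h mb mμ c v : X.presheaf.stalk y) (δ : X.presheaf.stalk y → X.presheaf.stalk y) (lam : X.presheaf.stalk y),
    IsUnit c ∧ IsUnit v ∧ stalkIdeal H y = Ideal.span {h} ∧ stalkIdeal (monomialIdeal E) y = Ideal.span {mb} ∧
      stalkIdeal (monomialIdeal L) y = Ideal.span {mμ} ∧
      stalkIdeal I y = Ideal.span {h ^ p + v * (h - c * mμ) * mb * mμ ^ (p - 1)} ∧ IsDeriv δ ∧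
      (∀ K ∈ H :: boundaryOf E, y ∈ K.support → ∀ g ∈ stalkIdeal K y, δ g ∈ stalkIdeal K y) ∧
      IsUnit lam ∧ δ (v * c * mb) = lam * (v * c * mb)

/-- **THE LATENT-JET SHAPE `ncHypShapeLatJ p X E L H M`.**  Marking `p`; the `H`-entries of `E` and of `L` carry the label `0` (or
`V(H) = ∅`); `L` and `E` label the same boundary; a latent-jet datum at every point of `V(H)`; `supp M ⊆ V(H)`; `p` prime and `p = 0` in
every stalk.  NO arithmetic condition on the labels. DEFINITION (the «LatJet» class, list level). [new] [cite: CossartPiltant2008, Prop. 4.2] -/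
def ncHypShapeLatJ (p : ℕ) (X : Scheme.{0}) (E L : List (X.IdealSheafData × ℕ)) (H : X.IdealSheafData) (M : MarkedIdeal X) :
    Prop :=
  M.mult = p ∧ (∀ q ∈ E, q.1 = H → q.2 = 0 ∨ (H.support : Set X) = ∅) ∧ (∀ q ∈ L, q.1 = H → q.2 = 0 ∨ (H.support : Set X) = ∅) ∧
    boundaryOf L = boundaryOf E ∧ (∀ y : X, y ∈ H.support → LatJAt p E L H M.ideal y) ∧
    M.support ⊆ (H.support : Set X) ∧ p.Prime ∧ ∀ x : X, ((p : ℕ) : X.presheaf.stalk x) = 0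

variable {E L : List (X.IdealSheafData × ℕ)} {H K : X.IdealSheafData} {p : ℕ} {M : MarkedIdeal X}

namespace ncHypShapeLatJ

/-- the marking is `p` -/
theorem mult_eq (hP : ncHypShapeLatJ p X E L H M) : M.mult = p := hP.1

/-- the `H`-entries of `E` carry the label `0` (or `V(H) = ∅`) -/
theorem labelE (hP : ncHypShapeLatJ p X E L H M) {q : X.IdealSheafData × ℕ} (hq : q ∈ E) (hqH : q.1 = H) :
    q.2 = 0 ∨ (H.support : Set X) = ∅ := hP.2.1 q hq hqH

/-- the `H`-entries of `L` carry the label `0` (or `V(H) = ∅`) -/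
theorem labelL (hP : ncHypShapeLatJ p X E L H M) {q : X.IdealSheafData × ℕ} (hq : q ∈ L) (hqH : q.1 = H) :
    q.2 = 0 ∨ (H.support : Set X) = ∅ := hP.2.2.1 q hq hqH

/-- the two label lists have the same boundary -/
theorem boundaryOf_eq (hP : ncHypShapeLatJ p X E L H M) : boundaryOf L = boundaryOf E := hP.2.2.2.1

/-- the latent-jet datum at a point of `V(H)` -/
theorem latJAt (hP : ncHypShapeLatJ p X E L H M) {y : X} (hy : y ∈ H.support) : LatJAt p E L H M.ideal y := hP.2.2.2.2.1 y hy

/-- the Artin–Schreier presentation at a point of `V(H)` (the datum with its derivation forgotten) -/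
theorem exists_generator (hP : ncHypShapeLatJ p X E L H M) {x : X} (hx : x ∈ H.support) :
    ∃ h mb mμ c v : X.presheaf.stalk x, IsUnit c ∧ IsUnit v ∧ stalkIdeal H x = Ideal.span {h} ∧
      stalkIdeal (monomialIdeal E) x = Ideal.span {mb} ∧ stalkIdeal (monomialIdeal L) x = Ideal.span {mμ} ∧
      stalkIdeal M.ideal x = Ideal.span {h ^ p + v * (h - c * mμ) * mb * mμ ^ (p - 1)} := by
  obtain ⟨h, mb, mμ, c, v, -, -, hc, hv, hH, hb, hμ, hI, -⟩ := hP.latJAt hx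
  exact ⟨h, mb, mμ, c, v, hc, hv, hH, hb, hμ, hI⟩

/-- `supp(M) ⊆ V(H)` -/
theorem support_subset (hP : ncHypShapeLatJ p X E L H M) : M.support ⊆ (H.support : Set X) := hP.2.2.2.2.2.1

/-- `p` is prime -/
theorem prime (hP : ncHypShapeLatJ p X E L H M) : p.Prime := hP.2.2.2.2.2.2.1

/-- `p = 0` in every stalk -/
theorem cast_eq_zero (hP : ncHypShapeLatJ p X E L H M) (x : X) : ((p : ℕ) : X.presheaf.stalk x) = 0 := hP.2.2.2.2.2.2.2 x

/-- `expOf E H = 0` as soon as `V(H)` has a point -/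
theorem expOfE_eq_zero (hP : ncHypShapeLatJ p X E L H M) {y : X} (hy : y ∈ H.support) : expOf E H = 0 :=
  expOf_eq_zero_of_labels fun _ hq hqH => (hP.labelE hq hqH).resolve_right (Set.nonempty_iff_ne_empty.mp ⟨y, hy⟩)

/-- `expOf L H = 0` as soon as `V(H)` has a point -/
theorem expOfL_eq_zero (hP : ncHypShapeLatJ p X E L H M) {y : X} (hy : y ∈ H.support) : expOf L H = 0 :=
  expOf_eq_zero_of_labels fun _ hq hqH => (hP.labelL hq hqH).resolve_right (Set.nonempty_iff_ne_empty.mp ⟨y, hy⟩)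

/-- the s.n.c. frame in terms of `L` (same boundary) -/
theorem hasSNC_L (hP : ncHypShapeLatJ p X E L H M) (hEs : HasSNC (H :: boundaryOf E)) : HasSNC (H :: boundaryOf L) := by
  rw [hP.boundaryOf_eq]; exact hEs

end ncHypShapeLatJ

/-! ### §Root — the frame monomial at a `p`-divisible point is a `p`-th power up to a unit -/

/-- a product of units is a unit (lists). [folklore] -/
theorem isUnit_list_prod {R : Type*} [CommMonoid R] {l : List R} (h : ∀ a ∈ l, IsUnit a) : IsUnit l.prod := by
  induction l with
  | nil => exact isUnit_one
  | cons a l ih =>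
    rw [List.prod_cons]
    exact (h a List.mem_cons_self).mul (ih fun b hb => h b (List.mem_cons_of_mem _ hb))

/-- **grouping a labelled product into a `p`-th power**: if every entry of `E` whose sheaf lies outside `S` contributes a unit, and
the entries of each `K ∈ S` contribute `t_K^{label}` with `p ∣ expOf E K` or `t_K` a unit, then `∏ g = u·mᵖ` with `u` a unit.
[folklore] -/
theorem exists_unit_mul_pow_eq_prod {R : Type*} [CommRing R] (E : List (X.IdealSheafData × ℕ)) (p : ℕ) :
    ∀ (S : List X.IdealSheafData) (g : X.IdealSheafData × ℕ → R), (∀ q ∈ E, q.1 ∉ S → IsUnit (g q)) →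
      (∀ K ∈ S, ∃ t : R, (∀ q ∈ E, q.1 = K → g q = t ^ q.2) ∧ (p ∣ expOf E K ∨ IsUnit t)) →
        ∃ u m : R, IsUnit u ∧ (E.map g).prod = u * m ^ p := by
  classical
  intro S
  induction S with
  | nil =>
    intro g hg _
    exact ⟨(E.map g).prod, 1, isUnit_list_prod fun a ha => by
      obtain ⟨q, hq, rfl⟩ := List.mem_map.mp ha
      exact hg q hq (by simp), by rw [one_pow, mul_one]⟩
  | cons K S ih =>
    intro g hg hS
    obtain ⟨t, ht, hdiv⟩ := hS K List.mem_cons_self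
    obtain ⟨u, m, hu, hprod⟩ := ih (fun q => if q.1 = K then 1 else g q) (fun q hq hqS => by
        by_cases hqK : q.1 = K
        · rw [if_pos hqK]; exact isUnit_one
        · rw [if_neg hqK]; exact hg q hq (by simp [hqK, hqS])) (fun K' hK' => by
        by_cases hKK : K' = K
        · exact ⟨1, fun q _ hq => by rw [if_pos (hq.trans hKK), one_pow], Or.inr isUnit_one⟩
        · obtain ⟨t', ht', hdiv'⟩ := hS K' (List.mem_cons_of_mem _ hK')
          exact ⟨t', fun q hq hqK' => by rw [if_neg (fun h => hKK (hqK'.symm.trans h)), ht' q hq hqK'], hdiv'⟩)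
    rw [prod_map_eq_pow_expOf_mul E K g t ht, hprod]
    rcases hdiv with ⟨e, he⟩ | htu
    · exact ⟨u, t ^ e * m, hu, by rw [he, mul_pow, ← pow_mul]; ring⟩
    · exact ⟨t ^ expOf E K * u, m, (htu.pow _).mul hu, by ring⟩

/-- ★ **at a `p`-DIVISIBLE point the frame monomial is a `p`-th power up to a unit**: `𝓜(E)_y = (m₀ᵖ)` with `m₀ᵖ ≠ 0`
(s.n.c. frame; group the labelled parameters by divisor, `p ∣ expOf E K` along every member through `y`). [new] [folklore] -/
theorem exists_eq_span_pow_of_divPt (hEs : HasSNC (H :: boundaryOf E)) {y : X} (hyH : y ∈ H.support)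
    (hD : DivPt p E y) : ∃ m₀ : X.presheaf.stalk y, m₀ ^ p ≠ 0 ∧ stalkIdeal (monomialIdeal E) y = Ideal.span {m₀ ^ p} := by
  classical
  haveI : IsRegularLocalRing (X.presheaf.stalk y) := (hEs y).1
  haveI : IsDomain (X.presheaf.stalk y) := isDomain_of_isRegularLocalRing _
  obtain ⟨d, z, lab, hz, hlab, -⟩ := exists_isRsopPart_lab hEs List.mem_cons_self hyH
  have hE : ∀ q ∈ E, q.1 ∈ H :: boundaryOf E := fun q hq => List.mem_cons_of_mem _ (fst_mem_boundaryOf hq)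
  set g : X.IdealSheafData × ℕ → X.presheaf.stalk y := fun q => if y ∈ q.1.support then z (lab q.1) ^ q.2 else 1 with hg
  have hspan := stalkIdeal_monomialIdeal_eq_span_prod hlab E hE
  obtain ⟨u, m, hu, hprod⟩ := exists_unit_mul_pow_eq_prod E p (boundaryOf E) g
    (fun q hq hqS => absurd (fst_mem_boundaryOf hq) hqS) fun K _ => by
      by_cases hyK : y ∈ K.support
      · exact ⟨z (lab K), fun q _ hqK => by rw [hg]; simp only [hqK, if_pos hyK], Or.inl (hD.1 K hyK)⟩
      · exact ⟨1, fun q _ hqK => by rw [hg]; simp only [hqK, if_neg hyK, one_pow], Or.inr isUnit_one⟩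
  have hne : (E.map g).prod ≠ 0 := List.prod_ne_zero fun h0 => by
    obtain ⟨q, -, hq⟩ := List.mem_map.mp h0
    rw [hg] at hq
    by_cases hyq : y ∈ q.1.support
    · simp only [if_pos hyq] at hq; exact pow_ne_zero _ (hz.ne_zero _) hq
    · simp only [if_neg hyq] at hq; exact one_ne_zero hq
  refine ⟨m, fun hm => hne (by rw [hprod, hm, mul_zero]), ?_⟩
  rw [hspan, hprod, Ideal.span_singleton_mul_left_unit hu]

/-! ### §Exit — latent mass zero is the JET shape -/

/-- units lie outside the maximal ideal; a sum `a + b` with `a ∈ 𝔪` is a unit iff `b` is. [folklore] -/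
theorem isUnit_of_add_mem {R : Type*} [CommRing R] [IsLocalRing R] {a b : R} (ha : a ∈ maximalIdeal R) (hb : IsUnit b) :
    IsUnit (a + b) := by
  by_contra h
  have hab : a + b ∈ maximalIdeal R := (mem_maximalIdeal _).mpr (mem_nonunits_iff.mpr h)
  have := Ideal.sub_mem _ hab ha
  rw [add_sub_cancel_left] at this
  exact (mem_nonunits_iff.mp ((mem_maximalIdeal _).mp this)) hb

/-- ★ **TERMINAL EXIT INTO THE JET SHAPE**: a latent-jet datum of latent mass `0` is a T19 JET datum.  Along `V(H)` the latent monomial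
`m_μ` is a unit, so `𝓘 = (hᵖ + U·m_b)` with the unit `U = v·(h − c·m_μ)·m_μ^{p−1}` (T17a's unit-free shape); at a `p`-divisible point
`m_b = ε·m₀ᵖ` (§Root) and `r := U·ε` has `δ r ≡ −λ·v·c·ε·m_μᵖ (mod 𝔪_y)` — a UNIT — because
`δ(m₀ᵖ) = δ(m_μᵖ) = 0` (`p = 0`) and `δ h ∈ (h)`. [new] [cite: Kollar2007, (3.111) Step 3] [cite: Cutkosky2011, §8] -/
theorem ncHypShapeLatJ.toJet (hEs : HasSNC (H :: boundaryOf E)) (hP : ncHypShapeLatJ p X E L H M) (h0 : latMass L H = 0) :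
    ncHypShapeJet p X E H M := by
  classical
  have hp1 : 1 ≤ p := hP.prime.one_lt.le
  -- the unit-free binomial part
  have hF : ncHypShapeF p X E H M := by
    refine ⟨hP.mult_eq, fun _ hq hqH => hP.labelE hq hqH, fun x hx => ?_, hP.support_subset⟩
    obtain ⟨h, mb, mμ, c, v, hc, hv, hHx, hbx, hμx, hIx⟩ := hP.exists_generator hx
    have hunit : IsUnit mμ := by
      have htop := stalkIdeal_monomialIdeal_eq_top_of_latMass_eq_zero h0 hx
      rw [hμx, Ideal.span_singleton_eq_top] at htop
      exact htop
    have hh : h ∈ maximalIdeal _ := mem_maximalIdeal_of_stalkIdeal_eq_span hx hHx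
    have hl : IsUnit (h - c * mμ) := by
      rw [sub_eq_add_neg]
      exact isUnit_of_add_mem hh ((hc.mul hunit).neg)
    refine ⟨h, mb, v * (h - c * mμ) * mμ ^ (p - 1), (hv.mul hl).mul (hunit.pow _), hHx, hbx, ?_⟩
    rw [hIx, show h ^ p + v * (h - c * mμ) * mb * mμ ^ (p - 1) = h ^ p + v * (h - c * mμ) * mμ ^ (p - 1) * mb by ring]
  refine ⟨hF, hP.prime, hP.cast_eq_zero, fun y hy hD => ?_⟩
  -- the jet datum at a `p`-divisible point
  haveI : IsRegularLocalRing (X.presheaf.stalk y) := (hEs y).1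
  haveI : IsDomain (X.presheaf.stalk y) := isDomain_of_isRegularLocalRing _
  obtain ⟨h, mb, mμ, c, v, δ, lam, hc, hv, hHx, hbx, hμx, hIx, hδ, hlog, hlam, heig⟩ := hP.latJAt hy
  obtain ⟨m₀, hm₀, hbm⟩ := exists_eq_span_pow_of_divPt hEs hy hD
  have hunit : IsUnit mμ := by
    have htop := stalkIdeal_monomialIdeal_eq_top_of_latMass_eq_zero h0 hy
    rw [hμx, Ideal.span_singleton_eq_top] at htop
    exact htop
  have hh : h ∈ maximalIdeal _ := mem_maximalIdeal_of_stalkIdeal_eq_span hy hHx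
  -- `m_b = ε·m₀ᵖ`, `ε` a unit
  obtain ⟨ε, hε⟩ := Ideal.span_singleton_eq_span_singleton.mp (hbm.symm.trans hbx)
  have hmb : mb = ↑ε * m₀ ^ p := by rw [← hε, mul_comm]
  -- `δ(v c ε) = λ·(v c ε)` by cancelling `m₀ᵖ` (`δ(m₀ᵖ) = 0`)
  have hpow0 : δ (m₀ ^ p) = 0 := hδ.map_pow_eq_zero_of_natCast (hP.cast_eq_zero y) m₀
  have hpowμ : δ (mμ ^ p) = 0 := hδ.map_pow_eq_zero_of_natCast (hP.cast_eq_zero y) mμ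
  have hvce : δ (v * c * ↑ε) = lam * (v * c * ↑ε) := by
    have h1 : δ (v * c * mb) = m₀ ^ p * δ (v * c * ↑ε) := by
      rw [hmb, show v * c * (↑ε * m₀ ^ p) = (v * c * ↑ε) * m₀ ^ p by ring, hδ.leibniz, hpow0, mul_zero, zero_add]
    have h2 : m₀ ^ p * δ (v * c * ↑ε) = m₀ ^ p * (lam * (v * c * ↑ε)) := by
      rw [← h1, heig, hmb]; ring
    exact mul_left_cancel₀ hm₀ h2
  -- the jet coefficient `r = U·ε` and its derivative
  set U := v * (h - c * mμ) * mμ ^ (p - 1) with hU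
  have hδr : δ (U * ↑ε) = (h * δ (v * ↑ε * mμ ^ (p - 1)) + v * ↑ε * mμ ^ (p - 1) * δ h) + -(mμ ^ p * δ (v * c * ↑ε)) := by
    have hsplit : U * ↑ε = (v * ↑ε * mμ ^ (p - 1)) * h - (v * c * ↑ε) * mμ ^ p := by
      obtain ⟨q, hq⟩ : ∃ q, p = q + 1 := ⟨p - 1, by omega⟩
      rw [hU, hq, Nat.add_sub_cancel, pow_succ]; ring
    rw [hsplit, hδ.map_sub, hδ.leibniz (v * ↑ε * mμ ^ (p - 1)) h, hδ.leibniz (v * c * ↑ε) (mμ ^ p), hpowμ, mul_zero, zero_add]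
    ring
  have hr : IsUnit (δ (U * ↑ε)) := by
    rw [hδr]
    refine isUnit_of_add_mem (Ideal.add_mem _ (Ideal.mul_mem_right _ _ hh) (Ideal.mul_mem_left _ _ ?_)) ?_
    · have := hlog H List.mem_cons_self hy h (by rw [hHx]; exact Ideal.mem_span_singleton_self h)
      rw [hHx] at this
      exact (Ideal.span_singleton_le_iff_mem _).mpr hh this
    · rw [hvce]
      exact ((hunit.pow p).mul (hlam.mul ((hv.mul hc).mul ε.isUnit))).neg
  refine ⟨h, m₀, U * ↑ε, δ, hδ, hHx, ?_, ?_, hlog, hr⟩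
  · rw [hbm]; exact Ideal.mem_span_singleton_self _
  · rw [hIx, show h ^ p + U * ↑ε * m₀ ^ p = h ^ p + v * (h - c * mμ) * mb * mμ ^ (p - 1) by rw [hmb, hU]; ring]
    exact Ideal.mem_span_singleton_self _

/-! ### §Hop — permissibility of the latent face for the new class -/

/-- ★ **PERMISSIBILITY OF THE LATENT HOP** (L20a's argument for the new class): for a member `K` with `expOf L K ≥ 1`, the face
`V(H) ∩ V(K)` lies in `supp M`. [new] -/
theorem ncHypShapeLatJ.support_pair_subset (hP : ncHypShapeLatJ p X E L H M) (hLK : 1 ≤ expOf L K) :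
    ((((pairFace H K).sup id).support : Set X)) ⊆ M.support := by
  intro y hy
  have hyH : y ∈ H.support := (mem_support_finsetSup_iff _ y).mp hy H left_mem_pairFace
  have hyK : y ∈ K.support := (mem_support_finsetSup_iff _ y).mp hy K right_mem_pairFace
  obtain ⟨h, mb, mμ, c, v, -, -, hHx, -, hμx, hIx⟩ := hP.exists_generator hyH
  have hh : h ∈ maximalIdeal _ := mem_maximalIdeal_of_stalkIdeal_eq_span hyH hHx
  have hmμ : mμ ∈ maximalIdeal _ := by
    have hle := stalkIdeal_monomialIdeal_le_maximalIdeal_of_expOf hLK hyK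
    rw [hμx, Ideal.span_singleton_le_iff_mem] at hle
    exact hle
  have hp1 : 1 ≤ p := hP.prime.one_lt.le
  show y ∈ M.support
  rw [MarkedIdeal.mem_support_iff, hP.mult_eq, hIx, Ideal.span_singleton_le_iff_mem]
  refine Ideal.add_mem _ (Ideal.pow_mem_pow hh p) ?_
  have h1 : h - c * mμ ∈ maximalIdeal _ := Ideal.sub_mem _ hh (Ideal.mul_mem_left _ _ hmμ)
  have h2 := Ideal.mul_mem_mul h1 (Ideal.pow_mem_pow hmμ (p - 1))
  rw [← pow_succ', Nat.sub_add_cancel hp1] at h2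
  rw [show v * (h - c * mμ) * mb * mμ ^ (p - 1) = (v * mb) * ((h - c * mμ) * mμ ^ (p - 1)) by ring]
  exact Ideal.mul_mem_left _ _ h2

end Shape

end Summit.ResolutionOfSingularities.ResolutionOfSingularities.Theorems.DeltaCutClasses

end
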